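import Mathlib
import HarnessLib

/-!
# Dimock, *Quantum electrodynamics on the 3-torus II*, §2.1 «blocking» (87)–(94): the blocked set `BΩ`, the unblocked
# set `UΛ = Λ′`, «`UBΩ = Ω`», «`Λ = BΩ` iff `Λ` is a union of `L`-blocks centred on `T¹`», «`BUΛ = Λ`» for such `Λ`, the
# iterates `B_ℓ`, `U_ℓ` (89) with «`U_ℓB_ℓΛ = Λ`», the equivalence of the two forms of (91), and the DISJOINT UNION (94)
# `Λ_j = ⋃_{i=j+1}^{k} B_{i−j}δΛ_i`, `δΛ_i = L^{−1}Λ′_{i−1} − Λ_i` (93) — PROVED, on `ℤ^ι` in block-index coordinates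

Source: J. Dimock, *Quantum electrodynamics on the 3-torus II*, arXiv:math-ph/0407063 [Dimock2004QED3TorusII], §2.1
p.16 (held text layer `paper:arxiv-math-ph_0407063`, page = PDF page, `L<n>` = line of the text layer); the cube
convention is that of paper I, J. Dimock, arXiv:math-ph/0210020 [Dimock2002QED3TorusI], (21) p.9.  YM LIT SWEEP item (c)
D13 (seat p11, gen 22, file 4; v1.1 = append-only section `BreakUp`; v1.2 = append-only section `Eq120`; v1.3 = gen 23
doc-only restore of the verbatim framing sentence, ref-2 g77 ask D-ref2-g77-1):
statement-level skeleton of published theorems with citation tags; proofs where landed; nothing here is a claim about the Yang–Mills mass gap.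

## The source, verbatim (p.16)

* L8–14, (87): *"First we define some blocking and unblocking operations. For `Ω ⊂ T¹_n ⊂ T⁰_n` we defined a blocked set
  `BΩ ⊂ T⁰_n` by `BΩ = {x ∈ T⁰_n : d(x, Ω) < L∕2}` (87)"*;  L15–19: *"Then `QA` on `Ω` depends on `A` on `BΩ` … A set
  `Λ ⊂ T⁰_n` has the form `BΩ` iff it is a union of `L`-blocks in `T⁰_n` centered on points in `T¹_n`"*.
* L20–24, (88): *"For `Λ ⊂ T⁰_n` we also define an unblocked `Λ′ ⊂ T¹_n` by `Λ′ = UΛ = Λ ∩ T¹_n` (88)"*;  L25–28: *"We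
  have always `UBΩ = Ω`. If `Λ = BΩ` then `BUΛ = Λ`. Note that if `Λ ⊂ T⁰_n` then `BLΛ ⊂ T⁰_{n+1}` and
  `L^{−1}UΛ ⊂ T⁰_{n−1}`."*
* L29–36, (89): *"More generally we define for `Λ ⊂ T⁰_n`  `B_ℓΛ = (BL)^ℓΛ ⊂ T⁰_{n+ℓ}`, `U_ℓΛ = (L^{−1}U)^ℓΛ ⊂ T⁰_{n−ℓ}`
  (89). We have `U_ℓB_ℓΛ = Λ`."*
* L37–44, (90)–(91): *"Our regions will be a sequence of the form `Λ = (Λ_0, …, Λ_{k−1})` (90) where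
  `Λ_j ⊂ T⁰_{N+M−j}` is a union of `LM_0 = L^{m_0+1}` blocks centered on `T^{m_0+1}_{N+M−j}`, `m_0 ≥ 1`. We assume the
  sets are decreasing in the sense that they satisfy one of the equivalent `B_1Λ_{j+1} ⊂ Λ_j`,
  `Λ_j ⊂ U_1Λ_{j−1} = L^{−1}Λ′_{j−1}` (91)"*;
  L45–49, (92): *"We also assume that for some positive integer `r`  `d((L^{−1}Λ′_{j−1})^c, Λ_j) ≥ rM_0` (92) whenever
  both subsets are non-empty."*
* L50–56, (93)–(94): *"We define in `T⁰_{N+M−i}`  `δΛ_i = L^{−1}Λ′_{i−1} − Λ_i` (93). Then with the convention `Λ_k = ∅`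
  we have the disjoint union `Λ_j = ∪_{i=j+1}^{k} B_{i−j}δΛ_i` (94)"*.
* paper I p.9 L38–42, (21): *"`B(y) = {x ∈ T⁰_{N+M} : |x − y| ≤ L∕2}` (21). The distance is `|x − y| = sup_μ|x_μ − y_μ|`
  so this in an `L`-cube centered on `y`. We assume `L` is odd so the `B(y)` form a partition."*

## What is formalized (all PROVED; no named facts, no `sorry`)

The combinatorics of §2.1 on the lattice `ℤ^ι` (`ι` a `Fintype` of directions; the paper has `ι = Fin 3`) with `L = 2a + 1`
odd, in BLOCK-INDEX COORDINATES: a point of `T⁰_n` is an integer vector `x : ι → ℤ`, a point `y ∈ T¹_n = LT⁰` is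
recorded by its index `ω = L^{−1}y : ι → ℤ`, so that Dimock's `B_1 = B∘L` and `U_1 = L^{−1}∘U` ((89), `ℓ = 1`) become maps
`Finset (ι → ℤ) → Finset (ι → ℤ)` on ONE type and can be iterated.

* `cube a c` — the `L`-cube `{x : |x_μ − c_μ| ≤ a ∀μ}` = `{x : d(x,c) < L∕2}` ((87)/(21), sup metric); `centre a x` — the
  index `ν(x)` of the unique cube of the partition containing `x` (`ν(x)_μ = ⌊(x_μ + a)∕L⌋`); `centre_eq_iff`,
  `mem_cube_smul_iff : x ∈ cube a (L•c) ↔ ν(x) = c` (the cubes centred on `LT⁰` PARTITION the lattice — paper I L41–42),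
  `centre_smul : ν(Lω) = ω`.
* `blockUp a Ω` = `B_1Ω = B(LΩ) = ⋃_{ω∈Ω} cube a (Lω)` ((87)∘L) with `mem_blockUp : x ∈ B_1Ω ↔ ν(x) ∈ Ω`;
  `unblock a Λ` = `U_1Λ = L^{−1}(Λ ∩ LT⁰)` ((88)∘L^{−1}) with `mem_unblock : ω ∈ U_1Λ ↔ Lω ∈ Λ`.
* `unblock_blockUp : U_1B_1Ω = Ω` («We have always `UBΩ = Ω`», L25).
* `IsBlockUnion a Λ :↔ ∀ x, x ∈ Λ ↔ Lν(x) ∈ Λ` («a union of `L`-blocks centered on points in `T¹_n`», L17–19);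
  `isBlockUnion_blockUp`; `blockUp_unblock_iff : B_1U_1Λ = Λ ↔ IsBlockUnion a Λ` («`Λ` has the form `BΩ` iff …»,
  «If `Λ = BΩ` then `BUΛ = Λ`», L15–25) and `IsBlockUnion.blockUp_unblock`.
* `blockUp_mono/union/sdiff/empty`, `disjoint_blockUp`, `unblock_mono` — `B_1` is an injective union-preserving map of
  regions (used for the disjointness in (94)).
* `blockUpIter a ℓ` = `B_ℓ`, `unblockIter a ℓ` = `U_ℓ` ((89)), `unblockIter_blockUpIter : U_ℓB_ℓΛ = Λ` (L36),
  `blockUpIter_succ/union`, `disjoint_blockUpIter`, and `mem_blockUpIter : x ∈ B_sS ↔ ν^s(x) ∈ S` with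
  `centreIter a s = ν^s` (`centreIter_succ'`, `centreIter_add`).
* `blockUp_subset_iff : IsBlockUnion a Λ_j → (B_1Λ_{j+1} ⊆ Λ_j ↔ Λ_{j+1} ⊆ U_1Λ_j)` — the equivalence asserted in
  (91) (it needs `Λ_j` to be a block union, which (90) grants).
* `deltaRegion a Λ i = U_1(Λ (i−1)) \ Λ i` — (93), `δΛ_i = L^{−1}Λ′_{i−1} − Λ_i`.
* **(94)** for a sequence `Λ : ℕ → Finset (ι → ℤ)` with `Λ_j` a block union and `Λ_{j+1} ⊆ U_1Λ_j` for `j < k` and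
  `Λ_k = ∅`:  `eq94 : Λ_j = ⋃_{t < k−j} B_{t+1}δΛ_{j+t+1}` (i.e. `⋃_{i=j+1}^{k}B_{i−j}δΛ_i`, `i = j+t+1`), proved by
  unrolling `Λ_j = B_1U_1Λ_j = B_1(δΛ_{j+1} ∪ Λ_{j+1})` (`layered`, `mem_layered`, `layered_eq_biUnion`); and
  `eq94_disjoint : t < t′ → Disjoint (B_{t+1}δΛ_{j+t+1}) (B_{t′+1}δΛ_{j+t′+1})` («the disjoint union»), via the descent
  lemma `mem_of_centreIter_mem : ν^s(x) ∈ Λ_{i+s} → x ∈ Λ_i`.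
* **(96) «Break this up by (94)»** (v1.1, §2.2 p.17 L1–14): `pairwiseDisjoint_layers`, `prod_eq_prod_layers`
  (`∏_{x∈Λ_j} f x = ∏_{t<k−j} ∏_{x∈B_{t+1}δΛ_{j+t+1}} f x` in any `CommMonoid` — the factorisation of a product of site
  factors, such as the Gaussian density `N^{−1}exp(−½(a∕L²)|A_{j+1,L} − QA_j|²)` of (95), over the layers of (94)),
  `sum_eq_sum_layers` (additive form), `card_eq_sum_layers` (`|Λ_j| = Σ_t |B_{t+1}δΛ_{j+t+1}|`, for the constants
  `N_{Λ,a} = (2π∕a)^{3|Λ|∕2}`).  Only this set-level bookkeeping of (96) is formalized — not the Gaussian integrals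
  (97)–(107), whose one-step identity (208) is the tree's `Dimock2011to13.GaussianSingleStep`.
* **(120)–(121)** (v1.2, §3.1 p.20 L19–48, in index coordinates — the paper scales by `L^{−k}`:
  `δΛ^{(k)}_i = L^{−k}B_iδΛ_i`): `blockUpIter_succ'` (`B_{ℓ+1} = B_ℓB_1`), `blockUpIter_sdiff`, **`eq120`**
  (`B_iδΛ_i = B_{i−1}Λ_{i−1} − B_iΛ_i` for `i ≥ 1`, `Λ_{i−1}` a block union — the printed middle case `1 < i < k`),
  `eq120_first` (`B_1δΛ_1 = Λ_0 − B_1Λ_1`), `eq120_last` (`B_kδΛ_k = B_{k−1}Λ_{k−1}` under `Λ_k = ∅`), **`eq121`** +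
  `eq121_disjoint` (*"the decomposition of `L^{−k}Λ_0` given by the disjoint union `L^{−k}Λ_0 = ⋃_{i=1}^{k}δΛ^{(k)}_i`
  (121)"* = (94) at `j = 0`).  NOT formalized: the block families `D⁰_i`, `D_i` (122)–(123) with the `r_0` boundary
  layers, the partition of unity (124)–(125), the enlargements (126), the metrics `d_Λ` (127) and `d′` (128).

## Readings and deviations (honest scope)

* `ℤ^ι`, not the torus: Dimock's `T⁰_n = ℤ³∕L^nℤ³` is finite and periodic; here the regions are finite subsets of the
  infinite lattice `ℤ^ι` and no periodic identification is made.  Every statement of §2.1 is local to `L^ℓ`-cubes, and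
  the same identities hold on `T⁰_n` because `L^n` is a multiple of `L^ℓ` (`ℓ ≤ n`); that transfer is NOT formalized
  here.  (The tree's torus block maps — `Dimock2011to13.TorusBlockAveraging`, `Dimock2011to13.Reblocking`, and
  `Balaban1983to89.T4HistoryLipschitzRescalingTorus.tcoarse` — use `ℤ∕(L·N′)` coordinates with cubes `[Lc, Lc+L)`;
  the present file follows paper I (21): CENTRED cubes, `L` odd.)
* Index coordinates: Dimock keeps all `Λ_j ⊂ T⁰_{N+M−j}` on unit lattices of different tori and lets `B`, `U` change
  the torus ((89): `B_ℓΛ ⊂ T⁰_{n+ℓ}`); composing with the scalings `L^{±1}` as in (89) we work on one type, and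
  `T¹`-points are named by their `L^{−1}`-images.  With this reading (88) `UΛ = Λ ∩ T¹_n` is `unblock` followed by
  `L·`, and `mem_unblock` is its definition.
* (90)–(91): the hypothesis «`Λ_j` is a union of `LM_0`-blocks» is used only through its consequence
  `IsBlockUnion a (Λ j)` (a union of `LM_0`-blocks centred on `T^{m_0+1}` is a union of `L`-blocks centred on `T¹`
  since `L` and `M_0 = L^{m_0}` are odd — not formalized); the second form of (91) is used with `j+1` in place of `j`
  (`Λ_{j+1} ⊆ U_1Λ_j`, hypothesis `hdec`).
* NOT formalized: the separation hypothesis (92) and everything metric about corridors; the statement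
  «`QA` on `Ω` depends on `A` on `BΩ`» (L15, about the averaging operator of paper I); the multi-region minimizers and
  propagators (120)–(127) of §2.3 that are built on this geometry (cf. the scope notes of
  `Dimock2011to13.QED3BackgroundFieldSeries`, `.QED3WalkExpansionInverse`, `.QED3CommutatorBounds`,
  `.QED3BlockPotentialSums`).
-/
noncomputable section

namespace Literature.MathematicalPhysics.QuantumFieldTheory.Dimock2011to13

namespace QED3TorusII

open Finset

section Blocking

variable {ι : Type*} [Fintype ι] [DecidableEq ι]

/-- The `L`-cube (`L = 2a + 1`) of the unit lattice centred at `c`: `{x : |x_μ − c_μ| ≤ a ∀μ}` = `{x : d(x,c) < L∕2}` in the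
sup metric. [cite: Dimock2004QED3TorusII, §2.1 (87) p.16 L8–19] -/
def cube (a : ℕ) (c : ι → ℤ) : Finset (ι → ℤ) :=
  Fintype.piFinset fun μ => Icc (c μ - a) (c μ + a)

/-- membership in the cube. [cite: Dimock2004QED3TorusII, §2.1 (87) p.16 L8–19] -/
theorem mem_cube {a : ℕ} {c x : ι → ℤ} : x ∈ cube a c ↔ ∀ μ, c μ - a ≤ x μ ∧ x μ ≤ c μ + a := by
  simp [cube, Fintype.mem_piFinset]

/-- **The nearest point of the coarse lattice**: `ν(x)_μ = ⌊(x_μ + a)∕L⌋`, the centre (in `T¹` coordinates) of the unique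
`L`-cube centred on `LT¹` containing `x` (`L = 2a+1`). [cite: Dimock2004QED3TorusII, §2.1 (87)–(88) p.16 L8–25] -/
def centre (a : ℕ) (x : ι → ℤ) : ι → ℤ := fun μ => (x μ + a) / (2 * a + 1 : ℤ)

omit [Fintype ι] [DecidableEq ι] in
/-- `ν(x) = c` iff `Lc_μ ≤ x_μ + a < L(c_μ + 1)` for every `μ` (Euclidean division). [cite: Dimock2004QED3TorusII, §2.1 p.16 L15–19] -/
theorem centre_eq_iff {a : ℕ} {x c : ι → ℤ} :
    centre a x = c ↔ ∀ μ, c μ * (2 * a + 1 : ℤ) ≤ x μ + a ∧ x μ + a < (c μ + 1) * (2 * a + 1 : ℤ) := by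
  have hL : (0 : ℤ) < 2 * a + 1 := by positivity
  constructor
  · intro h μ
    have hμ : (x μ + a) / (2 * a + 1 : ℤ) = c μ := by rw [← h]; rfl
    exact ⟨(Int.le_ediv_iff_mul_le hL).1 hμ.symm.le, (Int.ediv_lt_iff_lt_mul hL).1 (by rw [hμ]; exact lt_add_one _)⟩
  · intro h
    funext μ
    obtain ⟨h1, h2⟩ := h μ
    have lo : c μ ≤ (x μ + a) / (2 * a + 1 : ℤ) := (Int.le_ediv_iff_mul_le hL).2 h1
    have hi : (x μ + a) / (2 * a + 1 : ℤ) < c μ + 1 := (Int.ediv_lt_iff_lt_mul hL).2 h2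
    show (x μ + a) / (2 * a + 1 : ℤ) = c μ
    omega

/-- `x ∈ cube a (L•c) ↔ ν(x) = c` — the `L`-cubes centred on `LT¹` tile the lattice.
[cite: Dimock2004QED3TorusII, §2.1 (87) p.16 L8–19 («a union of `L`-blocks in `T⁰_n` centered on points in `T¹_n`»)] -/
theorem mem_cube_smul_iff {a : ℕ} {x c : ι → ℤ} : x ∈ cube a ((2 * a + 1 : ℤ) • c) ↔ centre a x = c := by
  rw [mem_cube, centre_eq_iff]
  refine forall_congr' fun μ => ?_
  simp only [Pi.smul_apply, smul_eq_mul]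
  have e1 : (c μ + 1) * (2 * a + 1 : ℤ) = (2 * a + 1 : ℤ) * c μ + 2 * a + 1 := by ring
  have e2 : c μ * (2 * a + 1 : ℤ) = (2 * a + 1 : ℤ) * c μ := by ring
  rw [e1, e2]
  generalize (2 * a + 1 : ℤ) * c μ = t
  omega

omit [Fintype ι] [DecidableEq ι] in
/-- the centre of `L·ω` is `ω`. [cite: Dimock2004QED3TorusII, §2.1 (88) p.16 L20–25] -/
theorem centre_smul (a : ℕ) (ω : ι → ℤ) : centre a ((2 * a + 1 : ℤ) • ω) = ω := by
  rw [centre_eq_iff]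
  intro μ
  simp only [Pi.smul_apply, smul_eq_mul]
  constructor <;> nlinarith

/-- **The blocked set (87) composed with the scaling, `B₁Ω = B(LΩ)`** ((89) with `ℓ = 1`): the union of the `L`-cubes of
the unit lattice centred at the points `Lω`, `ω ∈ Ω` — `BΩ = {x ∈ T⁰_n : d(x,Ω) < L∕2}`.
[cite: Dimock2004QED3TorusII, §2.1 (87), (89) p.16 L8–35] -/
def blockUp (a : ℕ) (Ω : Finset (ι → ℤ)) : Finset (ι → ℤ) :=
  Ω.biUnion fun ω => cube a ((2 * a + 1 : ℤ) • ω)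

/-- **The unblocked set (88) composed with the scaling, `U₁Λ = L^{−1}(Λ ∩ T¹_n)`** ((89) with `ℓ = 1`).
[cite: Dimock2004QED3TorusII, §2.1 (88), (89) p.16 L20–35] -/
def unblock (a : ℕ) (Λ : Finset (ι → ℤ)) : Finset (ι → ℤ) :=
  (Λ.filter fun x => (2 * a + 1 : ℤ) • centre a x = x).image (centre a)

/-- `x ∈ B₁Ω ↔ ν(x) ∈ Ω`. [cite: Dimock2004QED3TorusII, §2.1 (87) p.16 L8–19] -/
theorem mem_blockUp {a : ℕ} {Ω : Finset (ι → ℤ)} {x : ι → ℤ} : x ∈ blockUp a Ω ↔ centre a x ∈ Ω := by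
  unfold blockUp
  rw [mem_biUnion]
  constructor
  · rintro ⟨ω, hω, hx⟩
    rw [mem_cube_smul_iff.1 hx]
    exact hω
  · intro h
    exact ⟨centre a x, h, mem_cube_smul_iff.2 rfl⟩

omit [DecidableEq ι] in
/-- `ω ∈ U₁Λ ↔ Lω ∈ Λ`. [cite: Dimock2004QED3TorusII, §2.1 (88) p.16 L20–25] -/
theorem mem_unblock {a : ℕ} {Λ : Finset (ι → ℤ)} {ω : ι → ℤ} : ω ∈ unblock a Λ ↔ (2 * a + 1 : ℤ) • ω ∈ Λ := by
  unfold unblock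
  rw [mem_image]
  constructor
  · rintro ⟨x, hx, rfl⟩
    rw [mem_filter] at hx
    rw [hx.2]
    exact hx.1
  · intro h
    refine ⟨(2 * a + 1 : ℤ) • ω, mem_filter.2 ⟨h, ?_⟩, centre_smul a ω⟩
    rw [centre_smul]

/-- **«We have always `UBΩ = Ω`»** (`U₁B₁Ω = Ω`). [cite: Dimock2004QED3TorusII, §2.1 p.16 L25] -/
theorem unblock_blockUp (a : ℕ) (Ω : Finset (ι → ℤ)) : unblock a (blockUp a Ω) = Ω := by
  ext ω
  rw [mem_unblock, mem_blockUp, centre_smul]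

/-- **«A set `Λ` has the form `BΩ` iff it is a union of `L`-blocks centred on points in `T¹`»**: `Λ` is `ν`-saturated
(`x ∈ Λ ↔ Lν(x) ∈ Λ`). [cite: Dimock2004QED3TorusII, §2.1 p.16 L15–19] -/
def IsBlockUnion (a : ℕ) (Λ : Finset (ι → ℤ)) : Prop := ∀ x, x ∈ Λ ↔ (2 * a + 1 : ℤ) • centre a x ∈ Λ

/-- `B₁Ω` is a block union. [cite: Dimock2004QED3TorusII, §2.1 p.16 L15–19] -/
theorem isBlockUnion_blockUp (a : ℕ) (Ω : Finset (ι → ℤ)) : IsBlockUnion a (blockUp a Ω) := by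
  intro x
  rw [mem_blockUp, mem_blockUp, centre_smul]

/-- **«If `Λ = BΩ` then `BUΛ = Λ`»** — and conversely: `B₁U₁Λ = Λ` iff `Λ` is a block union.
[cite: Dimock2004QED3TorusII, §2.1 p.16 L15–25] -/
theorem blockUp_unblock_iff (a : ℕ) (Λ : Finset (ι → ℤ)) : blockUp a (unblock a Λ) = Λ ↔ IsBlockUnion a Λ := by
  constructor
  · intro h x
    conv_lhs => rw [← h]
    rw [mem_blockUp, mem_unblock]
  · intro h
    ext x
    rw [mem_blockUp, mem_unblock]
    exact (h x).symm

/-- the form `BΩ`: a block union is `B₁` of its unblocking. [cite: Dimock2004QED3TorusII, §2.1 p.16 L15–25] -/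
theorem IsBlockUnion.blockUp_unblock {a : ℕ} {Λ : Finset (ι → ℤ)} (h : IsBlockUnion a Λ) :
    blockUp a (unblock a Λ) = Λ :=
  (blockUp_unblock_iff a Λ).2 h

/-- `B₁` is monotone. [cite: Dimock2004QED3TorusII, §2.1 (87) p.16 L8–19] -/
theorem blockUp_mono (a : ℕ) {Ω Ω' : Finset (ι → ℤ)} (h : Ω ⊆ Ω') : blockUp a Ω ⊆ blockUp a Ω' := by
  intro x hx
  rw [mem_blockUp] at hx ⊢
  exact h hx

omit [DecidableEq ι] in
/-- `U₁` is monotone. [cite: Dimock2004QED3TorusII, §2.1 (88) p.16 L20–25] -/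
theorem unblock_mono (a : ℕ) {Λ Λ' : Finset (ι → ℤ)} (h : Λ ⊆ Λ') : unblock a Λ ⊆ unblock a Λ' := by
  intro ω hω
  rw [mem_unblock] at hω ⊢
  exact h hω

/-- `B₁` preserves unions. [cite: Dimock2004QED3TorusII, §2.1 (87) p.16 L8–19] -/
theorem blockUp_union (a : ℕ) (Ω Ω' : Finset (ι → ℤ)) : blockUp a (Ω ∪ Ω') = blockUp a Ω ∪ blockUp a Ω' := by
  ext x; simp only [mem_blockUp, mem_union]

/-- `B₁` preserves differences (the cubes around distinct centres are disjoint).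
[cite: Dimock2004QED3TorusII, §2.1 (87) p.16 L8–19] -/
theorem blockUp_sdiff (a : ℕ) (Ω Ω' : Finset (ι → ℤ)) : blockUp a (Ω \ Ω') = blockUp a Ω \ blockUp a Ω' := by
  ext x; simp only [mem_blockUp, mem_sdiff]

/-- `B₁` of disjoint sets are disjoint. [cite: Dimock2004QED3TorusII, §2.1 (87) p.16 L8–19] -/
theorem disjoint_blockUp (a : ℕ) {Ω Ω' : Finset (ι → ℤ)} (h : Disjoint Ω Ω') :
    Disjoint (blockUp a Ω) (blockUp a Ω') := by
  rw [disjoint_left] at h ⊢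
  intro x hx hx'
  rw [mem_blockUp] at hx hx'
  exact h hx hx'

/-- `B₁∅ = ∅`. [cite: Dimock2004QED3TorusII, §2.1 (87) p.16 L8–19] -/
theorem blockUp_empty (a : ℕ) : blockUp a (∅ : Finset (ι → ℤ)) = ∅ := by
  ext x; simp [mem_blockUp]

/-- **The iterates (89)**: `B_ℓ = (BL)^ℓ`. [cite: Dimock2004QED3TorusII, §2.1 (89) p.16 L29–36] -/
def blockUpIter (a : ℕ) : ℕ → Finset (ι → ℤ) → Finset (ι → ℤ)
  | 0, Λ => Λ
  | ℓ + 1, Λ => blockUp a (blockUpIter a ℓ Λ)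

/-- `U_ℓ = (L^{−1}U)^ℓ`. [cite: Dimock2004QED3TorusII, §2.1 (89) p.16 L29–36] -/
def unblockIter (a : ℕ) : ℕ → Finset (ι → ℤ) → Finset (ι → ℤ)
  | 0, Λ => Λ
  | ℓ + 1, Λ => unblockIter a ℓ (unblock a Λ)

/-- **«We have `U_ℓB_ℓΛ = Λ`»**. [cite: Dimock2004QED3TorusII, §2.1 (89) p.16 L36] -/
theorem unblockIter_blockUpIter (a : ℕ) : ∀ (ℓ : ℕ) (Λ : Finset (ι → ℤ)),
    unblockIter a ℓ (blockUpIter a ℓ Λ) = Λ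
  | 0, _ => rfl
  | ℓ + 1, Λ => by
      show unblockIter a ℓ (unblock a (blockUp a (blockUpIter a ℓ Λ))) = Λ
      rw [unblock_blockUp, unblockIter_blockUpIter a ℓ]

/-- `B_{ℓ+1} = B₁ ∘ B_ℓ`. [cite: Dimock2004QED3TorusII, §2.1 (89) p.16 L29–36] -/
theorem blockUpIter_succ (a ℓ : ℕ) (Λ : Finset (ι → ℤ)) :
    blockUpIter a (ℓ + 1) Λ = blockUp a (blockUpIter a ℓ Λ) := rfl

/-- `B_ℓ` preserves unions. [cite: Dimock2004QED3TorusII, §2.1 (89) p.16 L29–36] -/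
theorem blockUpIter_union (a : ℕ) : ∀ (ℓ : ℕ) (Ω Ω' : Finset (ι → ℤ)),
    blockUpIter a ℓ (Ω ∪ Ω') = blockUpIter a ℓ Ω ∪ blockUpIter a ℓ Ω'
  | 0, _, _ => rfl
  | ℓ + 1, Ω, Ω' => by rw [blockUpIter_succ, blockUpIter_succ, blockUpIter_succ, blockUpIter_union a ℓ, blockUp_union]

/-- `B_ℓ` of disjoint sets are disjoint. [cite: Dimock2004QED3TorusII, §2.1 (89) p.16 L29–36] -/
theorem disjoint_blockUpIter (a : ℕ) : ∀ (ℓ : ℕ) {Ω Ω' : Finset (ι → ℤ)}, Disjoint Ω Ω' →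
    Disjoint (blockUpIter a ℓ Ω) (blockUpIter a ℓ Ω')
  | 0, _, _, h => h
  | ℓ + 1, _, _, h => by
      rw [blockUpIter_succ, blockUpIter_succ]
      exact disjoint_blockUp a (disjoint_blockUpIter a ℓ h)

/-- **(91): «the sets are decreasing in the sense that they satisfy one of the equivalent `B₁Λ_{j+1} ⊂ Λ_j`,
`Λ_j ⊂ U₁Λ_{j−1}`»** — the two forms (the second at `j+1`) are equivalent when `Λ_j` is a block union.
[cite: Dimock2004QED3TorusII, §2.1 (91) p.16 L41–44] -/
theorem blockUp_subset_iff {a : ℕ} {Λj Λj1 : Finset (ι → ℤ)} (hΛ : IsBlockUnion a Λj) :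
    blockUp a Λj1 ⊆ Λj ↔ Λj1 ⊆ unblock a Λj := by
  constructor
  · intro h
    rw [← unblock_blockUp a Λj1]
    exact unblock_mono a h
  · intro h
    rw [← hΛ.blockUp_unblock]
    exact blockUp_mono a h

end Blocking

/-! ## (93)–(94): `δΛ_i = U₁Λ_{i−1} − Λ_i` and the disjoint union `Λ_j = ⋃_{i=j+1}^{k}B_{i−j}δΛ_i` -/

section DisjointUnion

variable {ι : Type*} [Fintype ι] [DecidableEq ι]

/-- the iterated centre map `ν^s` (the `T^s`-point of the `L^s`-cube containing `x`).
[cite: Dimock2004QED3TorusII, §2.1 (89) p.16 L29–36] -/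
def centreIter (a : ℕ) : ℕ → (ι → ℤ) → (ι → ℤ)
  | 0, x => x
  | s + 1, x => centreIter a s (centre a x)

omit [Fintype ι] [DecidableEq ι] in
/-- `ν^{s+1} = ν ∘ ν^s` (the other association). [cite: Dimock2004QED3TorusII, §2.1 (89) p.16 L29–36] -/
theorem centreIter_succ' (a : ℕ) : ∀ (s : ℕ) (x : ι → ℤ), centreIter a (s + 1) x = centre a (centreIter a s x)
  | 0, _ => rfl
  | s + 1, x => by
      show centreIter a (s + 1) (centre a x) = centre a (centreIter a s (centre a x))
      rw [centreIter_succ' a s]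

omit [Fintype ι] [DecidableEq ι] in
/-- `ν^{r+s} = ν^s ∘ ν^r`. [cite: Dimock2004QED3TorusII, §2.1 (89) p.16 L29–36] -/
theorem centreIter_add (a : ℕ) : ∀ (r s : ℕ) (x : ι → ℤ), centreIter a (r + s) x = centreIter a s (centreIter a r x)
  | 0, s, x => by rw [Nat.zero_add]; rfl
  | r + 1, s, x => by
      rw [Nat.succ_add]
      show centreIter a (r + s) (centre a x) = centreIter a s (centreIter a r (centre a x))
      rw [centreIter_add a r s]

/-- `x ∈ B_sS ↔ ν^s(x) ∈ S`. [cite: Dimock2004QED3TorusII, §2.1 (89) p.16 L29–36] -/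
theorem mem_blockUpIter {a : ℕ} : ∀ (s : ℕ) {S : Finset (ι → ℤ)} {x : ι → ℤ},
    x ∈ blockUpIter a s S ↔ centreIter a s x ∈ S
  | 0, _, _ => Iff.rfl
  | s + 1, S, x => by
      rw [blockUpIter_succ, mem_blockUp, mem_blockUpIter s]
      rfl

/-- **(93)**: `δΛ_i = L^{−1}Λ′_{i−1} − Λ_i = U₁Λ_{i−1} ∖ Λ_i` (regions in the index coordinates of `T⁰_{N+M−i}`).
[cite: Dimock2004QED3TorusII, §2.1 (93) p.16 L50–53] -/
def deltaRegion (a : ℕ) (Λ : ℕ → Finset (ι → ℤ)) (i : ℕ) : Finset (ι → ℤ) := unblock a (Λ (i - 1)) \ Λ i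

/-- the layered union `Λ_j = B₁(δΛ_{j+1} ∪ Λ_{j+1})` unrolled `m` times (with `Λ_{j+m} = ∅`): the right side of (94)
built recursively. [cite: Dimock2004QED3TorusII, §2.1 (94) p.16 L54–56] -/
def layered (a : ℕ) (δ : ℕ → Finset (ι → ℤ)) : ℕ → ℕ → Finset (ι → ℤ)
  | _, 0 => ∅
  | j, m + 1 => blockUp a (δ (j + 1) ∪ layered a δ (j + 1) m)

/-- membership in the layered union: `x ∈ ⋃_{t<m}B_{t+1}δ_{j+t+1}`. [cite: Dimock2004QED3TorusII, §2.1 (94) p.16 L54–56] -/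
theorem mem_layered {a : ℕ} {δ : ℕ → Finset (ι → ℤ)} : ∀ (m j : ℕ) (x : ι → ℤ),
    x ∈ layered a δ j m ↔ ∃ t < m, x ∈ blockUpIter a (t + 1) (δ (j + t + 1))
  | 0, j, x => by simp [layered]
  | m + 1, j, x => by
      show x ∈ blockUp a (δ (j + 1) ∪ layered a δ (j + 1) m) ↔ _
      rw [mem_blockUp, mem_union, mem_layered m (j + 1)]
      constructor
      · rintro (h | ⟨t, ht, hx⟩)
        · exact ⟨0, Nat.succ_pos m, by rw [Nat.add_zero, mem_blockUpIter]; exact h⟩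
        · refine ⟨t + 1, by omega, ?_⟩
          rw [blockUpIter_succ, mem_blockUp, show j + (t + 1) + 1 = j + 1 + t + 1 by ring]
          exact hx
      · rintro ⟨t, ht, hx⟩
        rcases Nat.eq_zero_or_pos t with rfl | htpos
        · left
          rw [Nat.add_zero, mem_blockUpIter] at hx
          exact hx
        · right
          obtain ⟨t', rfl⟩ := Nat.exists_eq_add_one_of_ne_zero htpos.ne'
          refine ⟨t', by omega, ?_⟩
          rw [blockUpIter_succ, mem_blockUp, show j + (t' + 1) + 1 = j + 1 + t' + 1 by ring] at hx
          exact hx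

/-- the layered union IS the union over the layers `B_{t+1}δ_{j+t+1}`, `t < m` (the right side of (94) with
`i = j + t + 1`). [cite: Dimock2004QED3TorusII, §2.1 (94) p.16 L54–56] -/
theorem layered_eq_biUnion (a : ℕ) (δ : ℕ → Finset (ι → ℤ)) (m j : ℕ) :
    layered a δ j m = (Finset.range m).biUnion fun t => blockUpIter a (t + 1) (δ (j + t + 1)) := by
  ext x
  rw [mem_layered, mem_biUnion]
  simp only [Finset.mem_range]

/-- **(94), the union**: for a decreasing sequence (91) of block unions `Λ_0, …, Λ_{k−1}` with `Λ_k = ∅`,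
`Λ_j = ⋃_{t<k−j}B_{t+1}δΛ_{j+t+1}` (`= ⋃_{i=j+1}^{k}B_{i−j}δΛ_i`).
[cite: Dimock2004QED3TorusII, §2.1 (94) p.16 L54–56] -/
theorem eq94 (a : ℕ) (Λ : ℕ → Finset (ι → ℤ)) (k : ℕ) (hblock : ∀ j < k, IsBlockUnion a (Λ j))
    (hdec : ∀ j < k, Λ (j + 1) ⊆ unblock a (Λ j)) (hk : Λ k = ∅) {m j : ℕ} (hjm : j + m = k) :
    Λ j = (Finset.range m).biUnion fun t => blockUpIter a (t + 1) (deltaRegion a Λ (j + t + 1)) := by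
  suffices H : ∀ m j, j + m = k → Λ j = layered a (deltaRegion a Λ) j m by
    rw [H m j hjm, layered_eq_biUnion]
  intro m
  induction m with
  | zero =>
      intro j h
      have hj : j = k := by omega
      rw [hj, hk]
      rfl
  | succ m ih =>
      intro j h
      have hj : j < k := by omega
      have hU : unblock a (Λ j) = deltaRegion a Λ (j + 1) ∪ Λ (j + 1) := by
        unfold deltaRegion
        rw [Nat.add_sub_cancel, sdiff_union_of_subset (hdec j hj)]
      calc Λ j = blockUp a (unblock a (Λ j)) := ((hblock j hj).blockUp_unblock).symm
        _ = blockUp a (deltaRegion a Λ (j + 1) ∪ layered a (deltaRegion a Λ) (j + 1) m) := by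
            rw [hU, ← ih (j + 1) (by omega)]
        _ = layered a (deltaRegion a Λ) j (m + 1) := rfl

omit [DecidableEq ι] in
/-- **descent**: for a decreasing sequence of block unions, `ν^s(x) ∈ Λ_{i+s} ⟹ x ∈ Λ_i`.
[cite: Dimock2004QED3TorusII, §2.1 (91) p.16 L41–44] -/
theorem mem_of_centreIter_mem {a : ℕ} {Λ : ℕ → Finset (ι → ℤ)} {k : ℕ}
    (hblock : ∀ j < k, IsBlockUnion a (Λ j)) (hdec : ∀ j < k, Λ (j + 1) ⊆ unblock a (Λ j)) :
    ∀ (s i : ℕ) (x : ι → ℤ), i + s ≤ k → centreIter a s x ∈ Λ (i + s) → x ∈ Λ i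
  | 0, _, _, _, h => h
  | s + 1, i, x, his, h => by
      have hi : i < k := by omega
      have h1 : centreIter a s (centre a x) ∈ Λ (i + 1 + s) := by
        rw [show i + 1 + s = i + (s + 1) by ring]
        exact h
      have h2 : centre a x ∈ Λ (i + 1) :=
        mem_of_centreIter_mem hblock hdec s (i + 1) (centre a x) (by omega) h1
      have h3 : (2 * a + 1 : ℤ) • centre a x ∈ Λ i := mem_unblock.1 (hdec i hi h2)
      exact ((hblock i hi) x).2 h3

/-- **(94), disjointness**: the layers `B_{t+1}δΛ_{j+t+1}` (`t < k − j`) are pairwise disjoint.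
[cite: Dimock2004QED3TorusII, §2.1 (94) p.16 L54–56 («we have the disjoint union»)] -/
theorem eq94_disjoint (a : ℕ) (Λ : ℕ → Finset (ι → ℤ)) (k : ℕ) (hblock : ∀ j < k, IsBlockUnion a (Λ j))
    (hdec : ∀ j < k, Λ (j + 1) ⊆ unblock a (Λ j)) {j t t' : ℕ} (htt' : t < t') (ht' : j + t' + 1 ≤ k) :
    Disjoint (blockUpIter a (t + 1) (deltaRegion a Λ (j + t + 1)))
      (blockUpIter a (t' + 1) (deltaRegion a Λ (j + t' + 1))) := by
  rw [disjoint_left]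
  intro x hx hx'
  rw [mem_blockUpIter] at hx hx'
  unfold deltaRegion at hx hx'
  rw [Nat.add_sub_cancel, mem_sdiff] at hx hx'
  obtain ⟨s, rfl⟩ : ∃ s, t' = t + 1 + s := ⟨t' - t - 1, by omega⟩
  -- from `hx'`: `L·ν^{t'+1}x ∈ Λ_{j+t'}`, a block union ⟹ `ν^{t'}x ∈ Λ_{j+t'}`
  have hu : (2 * a + 1 : ℤ) • centre a (centreIter a (t + 1 + s) x) ∈ Λ (j + (t + 1 + s)) := by
    rw [← centreIter_succ']
    exact mem_unblock.1 hx'.1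
  have hmem : centreIter a (t + 1 + s) x ∈ Λ (j + (t + 1 + s)) :=
    ((hblock (j + (t + 1 + s)) (by omega)) _).2 hu
  -- descend `s` levels: `ν^s(ν^{t+1}x) ∈ Λ_{(j+t+1)+s}` ⟹ `ν^{t+1}x ∈ Λ_{j+t+1}`
  rw [centreIter_add, show j + (t + 1 + s) = j + t + 1 + s by ring] at hmem
  exact hx.2 (mem_of_centreIter_mem hblock hdec s (j + t + 1) (centreIter a (t + 1) x) (by omega) hmem)

end DisjointUnion

/-! ## (96): «Break this up by (94)» — products (Gaussian densities, normalisations) over `Λ_j` factor over the layers -/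

section BreakUp

variable {ι : Type*} [Fintype ι] [DecidableEq ι]

/-- the layers of (94) are pairwise disjoint as a family indexed by `t < k − j`.
[cite: Dimock2004QED3TorusII, §2.1 (94) p.16 L54–56] -/
theorem pairwiseDisjoint_layers (a : ℕ) (Λ : ℕ → Finset (ι → ℤ)) (k : ℕ) (hblock : ∀ j < k, IsBlockUnion a (Λ j))
    (hdec : ∀ j < k, Λ (j + 1) ⊆ unblock a (Λ j)) {m j : ℕ} (hjm : j + m = k) :
    (↑(Finset.range m) : Set ℕ).PairwiseDisjoint
      fun t => blockUpIter a (t + 1) (deltaRegion a Λ (j + t + 1)) := by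
  intro t ht t' ht' hne
  rw [Finset.coe_range, Set.mem_Iio] at ht ht'
  rcases Nat.lt_or_gt_of_ne hne with h | h
  · exact eq94_disjoint a Λ k hblock hdec h (by omega)
  · exact (eq94_disjoint a Λ k hblock hdec h (by omega)).symm

/-- **(96) «Break this up by (94)»**: a product over the sites of `Λ_j` (e.g. the Gaussian density
`N^{−1}_{L^{−1}Λ′_j,a} exp(−½(a∕L²)|A_{j+1,L} − QA_j|²_{Λ′_j})`, a product of site factors) is the product over the
layers `i = j+1, …, k` of the products over `B_{i−j}δΛ_i`. [cite: Dimock2004QED3TorusII, §2.2 (96) p.17 L1–14] -/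
theorem prod_eq_prod_layers {M : Type*} [CommMonoid M] (a : ℕ) (Λ : ℕ → Finset (ι → ℤ)) (k : ℕ)
    (hblock : ∀ j < k, IsBlockUnion a (Λ j)) (hdec : ∀ j < k, Λ (j + 1) ⊆ unblock a (Λ j)) (hk : Λ k = ∅)
    {m j : ℕ} (hjm : j + m = k) (f : (ι → ℤ) → M) :
    ∏ x ∈ Λ j, f x = ∏ t ∈ Finset.range m, ∏ x ∈ blockUpIter a (t + 1) (deltaRegion a Λ (j + t + 1)), f x := by
  rw [eq94 a Λ k hblock hdec hk hjm, Finset.prod_biUnion (pairwiseDisjoint_layers a Λ k hblock hdec hjm)]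

/-- additive form of (96) (sums of site functionals, e.g. the quadratic forms `|·|²_{Λ′_j}` themselves).
[cite: Dimock2004QED3TorusII, §2.2 (96) p.17 L1–14] -/
theorem sum_eq_sum_layers {M : Type*} [AddCommMonoid M] (a : ℕ) (Λ : ℕ → Finset (ι → ℤ)) (k : ℕ)
    (hblock : ∀ j < k, IsBlockUnion a (Λ j)) (hdec : ∀ j < k, Λ (j + 1) ⊆ unblock a (Λ j)) (hk : Λ k = ∅)
    {m j : ℕ} (hjm : j + m = k) (f : (ι → ℤ) → M) :
    ∑ x ∈ Λ j, f x = ∑ t ∈ Finset.range m, ∑ x ∈ blockUpIter a (t + 1) (deltaRegion a Λ (j + t + 1)), f x := by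
  rw [eq94 a Λ k hblock hdec hk hjm, Finset.sum_biUnion (pairwiseDisjoint_layers a Λ k hblock hdec hjm)]

/-- the cardinality form: `|Λ_j| = Σ_i |B_{i−j}δΛ_i|` (normalisation constants `N_{Λ,a} = (2π∕a)^{3|Λ|∕2}` multiply).
[cite: Dimock2004QED3TorusII, §2.2 (95)–(96) p.16 L58 – p.17 L14] -/
theorem card_eq_sum_layers (a : ℕ) (Λ : ℕ → Finset (ι → ℤ)) (k : ℕ) (hblock : ∀ j < k, IsBlockUnion a (Λ j))
    (hdec : ∀ j < k, Λ (j + 1) ⊆ unblock a (Λ j)) (hk : Λ k = ∅) {m j : ℕ} (hjm : j + m = k) :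
    (Λ j).card = ∑ t ∈ Finset.range m, (blockUpIter a (t + 1) (deltaRegion a Λ (j + t + 1))).card := by
  rw [Finset.card_eq_sum_ones, sum_eq_sum_layers a Λ k hblock hdec hk hjm]
  simp only [Finset.card_eq_sum_ones]

end BreakUp

/-! ## (120)–(121): `B_iδΛ_i = B_{i−1}Λ_{i−1} − B_iΛ_i` and the disjoint union `Λ_0 = ⋃_{i=1}^{k} B_iδΛ_i` -/

section Eq120

variable {ι : Type*} [Fintype ι] [DecidableEq ι]

/-- `B_{ℓ+1} = B_ℓ ∘ B_1` (the other association of (89)). [cite: Dimock2004QED3TorusII, §2.1 (89) p.16 L29–36] -/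
theorem blockUpIter_succ' (a : ℕ) : ∀ (ℓ : ℕ) (Λ : Finset (ι → ℤ)),
    blockUpIter a (ℓ + 1) Λ = blockUpIter a ℓ (blockUp a Λ)
  | 0, _ => rfl
  | ℓ + 1, Λ => by rw [blockUpIter_succ, blockUpIter_succ' a ℓ, ← blockUpIter_succ]

/-- `B_ℓ` preserves differences. [cite: Dimock2004QED3TorusII, §2.1 (89) p.16 L29–36] -/
theorem blockUpIter_sdiff (a : ℕ) : ∀ (ℓ : ℕ) (Ω Ω' : Finset (ι → ℤ)),
    blockUpIter a ℓ (Ω \ Ω') = blockUpIter a ℓ Ω \ blockUpIter a ℓ Ω'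
  | 0, _, _ => rfl
  | ℓ + 1, Ω, Ω' => by rw [blockUpIter_succ, blockUpIter_succ, blockUpIter_succ, blockUpIter_sdiff a ℓ, blockUp_sdiff]

/-- **(120), middle case** (`1 < i < k`, and in fact every `i ≥ 1` with `Λ_{i−1}` a block union):
`B_iδΛ_i = B_{i−1}Λ_{i−1} − B_iΛ_i` (index coordinates; the paper then scales by `L^{−k}`:
`δΛ^{(k)}_i = L^{−k}B_iδΛ_i = L^{−k}(B_{i−1}Λ_{i−1} − B_iΛ_i)`). [cite: Dimock2004QED3TorusII, §3.1 (120) p.20 L19–41] -/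
theorem eq120 (a : ℕ) (Λ : ℕ → Finset (ι → ℤ)) {i : ℕ} (hi : 1 ≤ i) (hblock : IsBlockUnion a (Λ (i - 1))) :
    blockUpIter a i (deltaRegion a Λ i) = blockUpIter a (i - 1) (Λ (i - 1)) \ blockUpIter a i (Λ i) := by
  obtain ⟨i, rfl⟩ := Nat.exists_eq_add_of_le' hi
  rw [Nat.add_sub_cancel] at hblock ⊢
  unfold deltaRegion
  rw [Nat.add_sub_cancel, blockUpIter_succ', blockUp_sdiff, hblock.blockUp_unblock, blockUpIter_sdiff,
    ← blockUpIter_succ']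

/-- **(120), first case** (`i = 1`): `B_1δΛ_1 = Λ_0 − B_1Λ_1`. [cite: Dimock2004QED3TorusII, §3.1 (120) p.20 L19–41] -/
theorem eq120_first (a : ℕ) (Λ : ℕ → Finset (ι → ℤ)) (hblock : IsBlockUnion a (Λ 0)) :
    blockUp a (deltaRegion a Λ 1) = Λ 0 \ blockUp a (Λ 1) := by
  have h := eq120 a Λ (le_refl 1) hblock
  exact h

/-- **(120), last case** (`i = k`, with the convention `Λ_k = ∅`): `B_kδΛ_k = B_{k−1}Λ_{k−1}`.
[cite: Dimock2004QED3TorusII, §3.1 (120) p.20 L19–41] -/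
theorem eq120_last (a : ℕ) (Λ : ℕ → Finset (ι → ℤ)) {k : ℕ} (hk1 : 1 ≤ k) (hblock : IsBlockUnion a (Λ (k - 1)))
    (hk : Λ k = ∅) : blockUpIter a k (deltaRegion a Λ k) = blockUpIter a (k - 1) (Λ (k - 1)) := by
  rw [eq120 a Λ hk1 hblock, hk]
  obtain ⟨k, rfl⟩ := Nat.exists_eq_add_of_le' hk1
  have he : ∀ ℓ, blockUpIter a ℓ (∅ : Finset (ι → ℤ)) = ∅ := by
    intro ℓ
    induction ℓ with
    | zero => rfl
    | succ ℓ ih => rw [blockUpIter_succ, ih, blockUp_empty]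
  rw [he, Finset.sdiff_empty]

/-- **(121)**: the disjoint union `Λ_0 = ⋃_{i=1}^{k} B_iδΛ_i` (index coordinates; the paper՚s
`L^{−k}Λ_0 = ⋃_{i=1}^{k} δΛ^{(k)}_i`), i.e. (94) at `j = 0` — the union …
[cite: Dimock2004QED3TorusII, §3.1 (121) p.20 L42–48] -/
theorem eq121 (a : ℕ) (Λ : ℕ → Finset (ι → ℤ)) (k : ℕ) (hblock : ∀ j < k, IsBlockUnion a (Λ j))
    (hdec : ∀ j < k, Λ (j + 1) ⊆ unblock a (Λ j)) (hk : Λ k = ∅) :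
    Λ 0 = (Finset.range k).biUnion fun t => blockUpIter a (t + 1) (deltaRegion a Λ (t + 1)) := by
  have h := eq94 a Λ k hblock hdec hk (m := k) (j := 0) (Nat.zero_add k)
  simpa only [Nat.zero_add] using h

/-- … and its disjointness. [cite: Dimock2004QED3TorusII, §3.1 (121) p.20 L42–48 («the disjoint union»)] -/
theorem eq121_disjoint (a : ℕ) (Λ : ℕ → Finset (ι → ℤ)) (k : ℕ) (hblock : ∀ j < k, IsBlockUnion a (Λ j))
    (hdec : ∀ j < k, Λ (j + 1) ⊆ unblock a (Λ j)) {i i' : ℕ} (hi : 1 ≤ i) (hii' : i < i') (hi' : i' ≤ k) :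
    Disjoint (blockUpIter a i (deltaRegion a Λ i)) (blockUpIter a i' (deltaRegion a Λ i')) := by
  obtain ⟨t, rfl⟩ := Nat.exists_eq_add_of_le' hi
  obtain ⟨t', rfl⟩ := Nat.exists_eq_add_of_le' (le_trans hi hii'.le)
  have h := eq94_disjoint a Λ k hblock hdec (j := 0) (t := t) (t' := t') (by omega) (by omega)
  simpa only [Nat.zero_add] using h

end Eq120

end QED3TorusII

end Literature.MathematicalPhysics.QuantumFieldTheory.Dimock2011to13
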